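import Mathlib
import Literature.Barriers.ValiantsHypothesis.AlgebraicNaturalProofs
import Summits.ValiantsHypothesis.ValiantsHypothesis.Theorems.BarrierLeverPartitionMinorsHitByVPStratifiedLayouts

/-!
# Route BarrierLever — item `PartitionMinorsHitByVP` (stmt-ValiantsHypothesis-19717):
# unions of BLOCK-WEIGHT classes (Young-symmetric layouts) are hit

Helper file (`--supports stmt-ValiantsHypothesis-19717`; cell valiant-natproofs, rung V4, 𝒟-side,
prover seat val-np-p6 gen 0). Definition-free. Closes NO item.

Fix a block `B ⊆ Fin h` (`b = #B`). The BLOCK WEIGHT of a set `T` is the pair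
`(#(T ∩ B), #(T \ B))`; its classes are the orbits of the Young subgroup `S_B × S_{Bᶜ}`. The
functional `λ = 𝟙_B + (b+1)·𝟙_{Bᶜ}` takes the value `#(T ∩ B) + (b+1)·#(T \ B)` — an injective
ENCODING of the block weight — so block-weight classes are strata of ONE threshold pair, and the
m-strata door (`…StrataDoor.partitionMinor_hit_of_automorphicStrata`, p448961) applies with an
ARBITRARY matching of classes: this is where a non-monotone `π` is indispensable (the encoding order
of the column classes is unrelated to that of the row classes).

* `sum_blockWeight` — `Σ_{a ∈ T} λ_a = #(T ∩ B) + (b+1)·#(T \ B)`.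
* `symmDiff_inter_block`, `symmDiff_sdiff_block` — block weights of a translate `T ∆ S` for
  `S ∈ {∅, B} ∪ {∅, Bᶜ}` (componentwise `k ↦ k` or `k ↦ size − k`).
* **`partitionMinor_hit_of_blockWeightClasses`** (UNCONDITIONAL CLASS, `b = 5`, `h ≥ 1`) — rows =
  ALL sets with block weight in `A ⊆ ℕ × ℕ`, columns = ALL sets with block weight in `τ(A)` where
  `τ` is injective on `A` and moves each component `k` to `k` or to its complement size
  (`#B − k`, resp. `(h − #B) − k`) ⇒ hit inside `SmallCircuits ℂ (h+h) 5`. `B = ∅` (or `univ`) is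
  `…partitionMinor_hit_of_weightClasses`; products of two weight-class layouts on `B` and `Bᶜ` are
  the case of a product matching `τ = τ₁ × τ₂`; general `τ` mixes the blocks. The number of strata,
  `≤ (h+1)²`, grows with `h`: the additive door is essential.

WHAT THIS IS NOT: a structured (Young-symmetric) class; nothing on generic layouts, on TT /
item 19616, on crux 14610 or on VP vs VNP.
-/

set_option linter.dupNamespace false

namespace Summit.ValiantsHypothesis.ValiantsHypothesis.Theorems.BarrierLever.StrataDoor

open Finset
open Literature.Barriers.ValiantsHypothesis

variable {h r : ℕ}

/-- The block-weight functional: `Σ_{a ∈ T} (a ∈ B ? 1 : q) = #(T ∩ B) + q·#(T \ B)`. -/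
theorem sum_blockWeight (B T : Finset (Fin h)) (q : ℤ) :
    (∑ a ∈ T, (if a ∈ B then (1 : ℤ) else q)) = ((T ∩ B).card : ℤ) + q * (T \ B).card := by
  classical
  rw [← Finset.sum_filter_add_sum_filter_not T (fun a => a ∈ B)]
  rw [Finset.sum_congr rfl (fun a ha => if_pos (Finset.mem_filter.mp ha).2),
    Finset.sum_congr rfl (fun a ha => if_neg (Finset.mem_filter.mp ha).2)]
  rw [Finset.sum_const, Finset.sum_const, nsmul_eq_mul, nsmul_eq_mul, mul_one,
    Finset.filter_mem_eq_inter, Finset.filter_notMem_eq_sdiff, mul_comm]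

/-- Block part of a translate by `S`: unchanged if `S ∩ B = ∅`, complemented inside `B` if `B ⊆ S`. -/
theorem symmDiff_inter_block (B T S : Finset (Fin h)) :
    (S ∩ B = ∅ → symmDiff T S ∩ B = T ∩ B) ∧ (B ⊆ S → symmDiff T S ∩ B = B \ T) := by
  classical
  constructor
  · intro hS
    ext a
    simp only [Finset.mem_inter, Finset.mem_symmDiff]
    have : a ∈ S → a ∈ B → False := fun h1 h2 => by
      have : a ∈ S ∩ B := Finset.mem_inter.mpr ⟨h1, h2⟩
      rw [hS] at this
      simp at this
    tauto
  · intro hS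
    ext a
    simp only [Finset.mem_inter, Finset.mem_symmDiff, Finset.mem_sdiff]
    have := @hS a
    tauto

/-- Off-block part of a translate by `S`: unchanged if `S \ B = ∅`, complemented off `B` if `Bᶜ ⊆ S`. -/
theorem symmDiff_sdiff_block (B T S : Finset (Fin h)) :
    (S \ B = ∅ → symmDiff T S \ B = T \ B) ∧ (Bᶜ ⊆ S → symmDiff T S \ B = Bᶜ \ T) := by
  classical
  constructor
  · intro hS
    ext a
    simp only [Finset.mem_sdiff, Finset.mem_symmDiff]
    have : a ∈ S → a ∉ B → False := fun h1 h2 => by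
      have : a ∈ S \ B := Finset.mem_sdiff.mpr ⟨h1, h2⟩
      rw [hS] at this
      simp at this
    tauto
  · intro hS
    ext a
    simp only [Finset.mem_sdiff, Finset.mem_symmDiff, Finset.mem_compl]
    have := @hS a
    simp only [Finset.mem_compl] at this
    tauto

/-- **Unions of block-weight classes are hit** (`b = 5`, `h ≥ 1`). -/
theorem partitionMinor_hit_of_blockWeightClasses (hh : 1 ≤ h) (u w : Fin r → Finset (Fin h))
    (hu : Function.Injective u) (B : Finset (Fin h)) (A : Finset (ℕ × ℕ)) (τ : ℕ × ℕ → ℕ × ℕ)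
    (hτ : ∀ k ∈ A, ((τ k).1 = k.1 ∨ (τ k).1 = B.card - k.1) ∧
      ((τ k).2 = k.2 ∨ (τ k).2 = (h - B.card) - k.2))
    (hτinj : ∀ k ∈ A, ∀ k' ∈ A, τ k = τ k' → k = k')
    (hU : ∀ T : Finset (Fin h), (∃ i, u i = T) ↔ ((T ∩ B).card, (T \ B).card) ∈ A)
    (hW : ∀ T : Finset (Fin h), (∃ j, w j = T) ↔ ∃ k ∈ A, ((T ∩ B).card, (T \ B).card) = τ k) :
    ∃ f ∈ SmallCircuits ℂ (h + h) 5,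
      (Matrix.of fun i j : Fin r => MvPolynomial.coeff
        (∑ a ∈ u i, Finsupp.single (Fin.castAdd h a) 1 +
          ∑ c ∈ w j, Finsupp.single (Fin.natAdd h c) 1) f).det ≠ 0 := by
  classical
  set b : ℕ := B.card with hb
  have hbh : b ≤ h := (Finset.card_le_univ B).trans (by simp)
  have hBc : Bᶜ.card = h - b := by rw [Finset.card_compl, Fintype.card_fin]
  -- block weights, encoding and decoding
  set κ : Finset (Fin h) → ℕ × ℕ := fun T => ((T ∩ B).card, (T \ B).card) with hκ
  set enc : ℕ × ℕ → ℕ := fun k => k.1 + (b + 1) * k.2 with henc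
  set dec : ℕ → ℕ × ℕ := fun t => (t % (b + 1), t / (b + 1)) with hdec
  have hdecenc : ∀ k : ℕ × ℕ, k.1 ≤ b → dec (enc k) = k := by
    intro k hk
    have h1 : (k.1 + (b + 1) * k.2) % (b + 1) = k.1 := by
      rw [Nat.add_mul_mod_self_left, Nat.mod_eq_of_lt (by omega)]
    have h2 : (k.1 + (b + 1) * k.2) / (b + 1) = k.2 := by
      rw [Nat.add_mul_div_left _ _ (by omega), Nat.div_eq_of_lt (by omega), zero_add]
    simp only [hdec, henc, h1, h2]
  have hencinj : ∀ k k' : ℕ × ℕ, k.1 ≤ b → k'.1 ≤ b → enc k = enc k' → k = k' :=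
    fun k k' hk hk' hkk => by rw [← hdecenc k hk, ← hdecenc k' hk', hkk]
  have hκ1 : ∀ T, (κ T).1 ≤ b := fun T => Finset.card_le_card Finset.inter_subset_right
  have hκ2 : ∀ T, (κ T).2 ≤ h - b := fun T => by
    rw [← hBc]
    exact Finset.card_le_card (fun a ha => by
      rw [Finset.mem_compl]; exact (Finset.mem_sdiff.mp ha).2)
  have hκA : ∀ i, κ (u i) ∈ A := fun i => (hU (u i)).mp ⟨i, rfl⟩
  have hτ1 : ∀ i, (τ (κ (u i))).1 ≤ b := fun i => by
    rcases (hτ _ (hκA i)).1 with h1 | h1 <;> rw [h1]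
    · exact hκ1 _
    · exact Nat.sub_le _ _
  -- strata and the per-class translation
  set lr : Fin r → ℕ := fun i => enc (κ (u i)) with hlr
  have hdeclr : ∀ i, dec (lr i) = κ (u i) := fun i => hdecenc _ (hκ1 _)
  set S : ℕ → Finset (Fin h) := fun t =>
    (if (τ (dec t)).1 = (dec t).1 then ∅ else B) ∪ (if (τ (dec t)).2 = (dec t).2 then ∅ else Bᶜ)
    with hS
  set T : Fin r → Finset (Fin h) := fun i => symmDiff (u i) (S (lr i)) with hT
  have hκT : ∀ i, κ (T i) = τ (κ (u i)) := by
    intro i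
    obtain ⟨hP1, hP2⟩ := hτ _ (hκA i)
    have hSi : S (lr i) = (if (τ (κ (u i))).1 = (κ (u i)).1 then ∅ else B) ∪
        (if (τ (κ (u i))).2 = (κ (u i)).2 then ∅ else Bᶜ) := by
      simp only [hS, hdeclr]
    refine Prod.ext ?_ ?_
    · show (symmDiff (u i) (S (lr i)) ∩ B).card = (τ (κ (u i))).1
      by_cases h1 : (τ (κ (u i))).1 = (κ (u i)).1
      · have hSB : S (lr i) ∩ B = ∅ := by
          rw [hSi, if_pos h1, Finset.empty_union]
          split_ifs
          · simp
          · ext a; simp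
        rw [(symmDiff_inter_block B (u i) (S (lr i))).1 hSB, h1]
      · have hSB : B ⊆ S (lr i) := by
          rw [hSi, if_neg h1]; exact Finset.subset_union_left
        rw [(symmDiff_inter_block B (u i) (S (lr i))).2 hSB, Finset.card_sdiff]
        rcases hP1 with h2 | h2
        · exact absurd h2 h1
        · rw [h2]
    · show (symmDiff (u i) (S (lr i)) \ B).card = (τ (κ (u i))).2
      by_cases h1 : (τ (κ (u i))).2 = (κ (u i)).2
      · have hSB : S (lr i) \ B = ∅ := by
          rw [hSi, if_pos h1, Finset.union_empty]
          split_ifs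
          · simp
          · ext a; simp
        rw [(symmDiff_sdiff_block B (u i) (S (lr i))).1 hSB, h1]
      · have hSB : Bᶜ ⊆ S (lr i) := by
          rw [hSi, if_neg h1]; exact Finset.subset_union_right
        rw [(symmDiff_sdiff_block B (u i) (S (lr i))).2 hSB, Finset.card_sdiff, hBc]
        rcases hP2 with h2 | h2
        · exact absurd h2 h1
        · rw [h2]
          have : u i ∩ Bᶜ = u i \ B := by
            ext a; simp [Finset.mem_sdiff, Finset.mem_compl]
          rw [this]
  have hTinj : Function.Injective T := by
    intro i i' hii
    have hk : κ (u i) = κ (u i') := by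
      have := congrArg κ hii
      rw [hκT, hκT] at this
      exact hτinj _ (hκA i) _ (hκA i') this
    have hl : lr i = lr i' := by simp only [hlr, hk]
    apply hu
    have : symmDiff (u i) (S (lr i)) = symmDiff (u i') (S (lr i)) := by
      have := hii
      simp only [hT] at this
      rwa [← hl] at this
    exact symmDiff_left_injective _ this
  have hTex : ∀ i, ∃ j, w j = T i := fun i => (hW (T i)).mpr ⟨κ (u i), hκA i, hκT i⟩
  choose e₀ he₀ using hTex
  have he₀inj : Function.Injective e₀ := fun i i' hii =>
    hTinj (by rw [← he₀ i, ← he₀ i', hii])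
  set e : Equiv.Perm (Fin r) := Equiv.ofBijective e₀ (Finite.injective_iff_bijective.mp he₀inj)
    with he
  have he_apply : ∀ i, e i = e₀ i := fun i => rfl
  -- the number of strata
  set m : ℕ := b + (b + 1) * (h - b) + 1 with hm
  have hm2 : m ≤ (h + h) ^ 2 := by
    obtain ⟨d, hd⟩ : ∃ d, h = b + d := ⟨h - b, by omega⟩
    have hsub : h - b = d := by omega
    rw [hm, hsub, hd]
    nlinarith
  have hlt : ∀ X : Finset (Fin h), enc (κ X) < m := by
    intro X
    have h1 := hκ1 X
    have h2 := hκ2 X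
    have h3 : (b + 1) * (κ X).2 ≤ (b + 1) * (h - b) := Nat.mul_le_mul_left _ h2
    show (κ X).1 + (b + 1) * (κ X).2 < b + (b + 1) * (h - b) + 1
    omega
  -- the functional `𝟙_B + (b+1)𝟙_{Bᶜ}` computes the encoding
  have hval : ∀ X : Finset (Fin h), (∑ a ∈ X, (if a ∈ B then (1 : ℤ) else ((b : ℤ) + 1))) =
      ((enc (κ X) : ℕ) : ℤ) := by
    intro X
    rw [sum_blockWeight]
    simp only [henc, hκ]
    push_cast
    ring
  have hmono : Monotone (fun t : ℕ => (t : ℤ) - 1) := fun a a' haa => by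
    show (a : ℤ) - 1 ≤ (a' : ℤ) - 1
    omega
  obtain ⟨f, hf, hne⟩ := partitionMinor_hit_of_automorphicStrata (r := r) 2 m hh hm2 u w hu
    (fun a => if a ∈ B then (1 : ℤ) else ((b : ℤ) + 1))
    (fun a => if a ∈ B then (1 : ℤ) else ((b : ℤ) + 1))
    lr (fun j => enc (κ (w j))) (fun t => enc (τ (dec t))) e
    (fun i => by
      show enc (κ (w (e i))) = enc (τ (dec (lr i)))
      rw [he_apply, he₀, hκT, hdeclr])
    (fun i j hij => by
      have hij' : enc (τ (κ (u i))) = enc (τ (κ (u j))) := by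
        have := hij
        simp only [hdeclr] at this
        exact this
      have := hencinj _ _ (hτ1 i) (hτ1 j) hij'
      have := hτinj _ (hκA i) _ (hκA j) this
      simp only [hlr, this])
    (fun i => hlt (u i))
    (fun t => (t : ℤ) - 1) (fun t => (t : ℤ) - 1) hmono hmono
    (fun i => by rw [hval]; push_cast; constructor <;> simp only [hlr] <;> linarith)
    (fun j => by rw [hval]; push_cast; constructor <;> linarith)
    (fun _ => Equiv.refl _) S
    (fun i => by rw [he_apply, he₀, Equiv.coe_refl, Finset.image_id])
  exact ⟨f, by simpa using hf, hne⟩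

end Summit.ValiantsHypothesis.ValiantsHypothesis.Theorems.BarrierLever.StrataDoor
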